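import Literature.NumberTheory.EllipticCurves.Kato2004.EulerSystemDefinedValues
import Literature.NumberTheory.EllipticCurves.Kato2004.IwasawaCohomologyZetaLift
import Literature.NumberTheory.EllipticCurves.Kato2004.LocPKummerLog
import Literature.NumberTheory.EllipticCurves.Kato2004.MemberMultiplierInputs
import HarnessLib

/-!
# The Perrin-Riou ratio `ℒ` of Kato's zeta element — a CLOSED predicate `PRRatio W p ℒ`
# («`ℒ = log_ω(loc_p z_ℚ)/log_ω(x)²` up to a `p`-adic unit, in the tree's `Ω_W`-currency») over a
# VALUE-PINNED Kato zeta datum (the interface binder `PRRatio` of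
# `Summit.BirchSwinnertonDyer.Rank1Residual.Additive.PerrinRiouUpToUnitAt`, CONSTRUCTED)

Topic `NumberTheory/EllipticCurves`, sub-directory `Kato2004` (namespace = path). Cell `bsd-cm`, seat
`bsd-cm-prr-ty1` (literature-prover; row (M2) of planner D347 / director-bsd g12 KEY 2026-08-28T03:44:36Z;
spec `run/shared/lean/pub/bsd-cm/bsd-cm-prr-ty1/SPEC-PRRATIO.md`). DEFINITIONS WITH BODIES (two `Prop`s: the
predicate over instance binders and its closed form) and unfolding lemmas; NO named fact, NO instance,
NO notation, NO `sorry`; nothing about Perrin-Riou's conjecture, Kato's Main Conjecture or BSD is asserted.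

## Why (the consumers, and the junk audit of record)

The rank-one Kato descent of cells `bsd-potss` / `bsd-cm`
(`Summits/…/Rank1Residual/Additive/KatoDescentRankOnePerrinRiou.lean`, parts 5–8b) states Perrin-Riou's
conjecture UP TO A `p`-ADIC UNIT as the node
`PerrinRiouUpToUnitAt PRRatio W p := r_an(W) = 1 → ∃ ℒ, PRRatio W p ℒ ∧ ℒ ≠ 0 ∧ v_p ℒ = v_p(L′(W,1)/(Ω_W·Reg W))`
over an OPEN interface binder `PRRatio : ∀ W p, ℚ_[p] → Prop` ("`ℒ` is the Perrin-Riou ratio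
`log_ω(loc_p z)/log_ω(x)²` of Kato's zeta element `z` and a generator `x` of `W(ℚ)/tors`"). A research stub
`∀ W ∈ 𝒞₇, PerrinRiouUpToUnitAt PRRatio W 7` over the OPEN binder is junk (planner D136/D137: `PRRatio := ⊥`
empties the class, `PRRatio := (· = 1)` asserts `7 ∤ #Ш`); cell `bsd-potss` (memos KMC-DESCENT v9/v10,
2026-08-27, findings F2–F5) showed moreover that over the tree's PROJECTIVELY pinned zeta data
(`Kato2004.ZetaBody`, whose dual-exponential value functional `Λ` is abstract) the node is of degree `−1` in the
lattice scale — not closed. This file CONSTRUCTS the binder, closing the scale, from objects four cells typed since: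
(Z1) `Kato2004.DefinedExpStarBody W p f d ι κ Λ` (cell bsd-addord/W2): Kato's Euler system for `T_pW` whose value
functional `Λ` IS the semi-local Bloch–Kato dual exponential at EVERY level, in the coordinate of a generator `d`
of `D⁰_dR(V_pW|_{Γ_ℚ_p})` — no level-wise rescaling is possible any more (memo v10 F3/F5);
(Z2) the Tate-duality NORMALISATION of `d` (shape of W2's `PAdicHodge.exists_smul_range_expStarCoord_iff_trace_log`
at `F = ℚ_p`): `exp*_d(H¹(ℚ_p,T_pW)) = {a : a·log_ω(E(ℚ_p)) ⊆ ℤ_p}`, which pins `d` to the Néron class up to `ℤ_pˣ`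
[Kato LNM 1553 II Thm. 1.4.1; Bloch–Kato Prop. 3.8, Ex. 3.11];
(Z3) the constant of Kato's value law is taken RATIONAL (`κ = q ∈ ℚ`) and DIVIDED OUT — by memo v10 F4 the only
symmetry surviving (Z1) is `(z, κ) ↦ (n•z, nκ)`, of degree `0` in `log(loc z)/κ`;
(Z4) calibration of Kato's `_{c,d}z(a(A))` by the trivial-character cusp factor `ratCuspFactor f true c d a A d′`
and the depletion `∏_{ℓ∣pA} eulerFactorAtOne W N ℓ` (cell bsd-potss, `Kato2004/MemberMultiplierInputs.lean`), and by
the rational period ratio `λ = Ω⁺_f/Ω_W`;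
(Z5) the Λ-adic PIN `Kato2004.IwasawaH1Data` + `levelToLayer` (seat bsd-potss-rkm, `IwasawaCohomologyZetaLift.lean`:
the lift is UNIQUE) and the finite-level Kummer logarithm `Kato2004.HasLocPKummerLog` / `padicLogLocal` /
`layerZeroToTop` (cell bsd-cn100, `LocPKummerLog.lean`).

## The element whose logarithm is taken, and the printed formula it transcribes

For the datum below, `z_{0,∅} = _{c,d}z₁^{(p)}(f,1,1,a(A),prime(pA)) ∈ H¹(ℤ[1/p], T_pW)` is the bottom class of
the family (Cor_{ℚ(μ_p)/ℚ} of the level-`p` class; no Euler factor in the `p`-direction, Kato Prop. 8.12) and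
`𝐲 ∈ 𝐇¹_Γ(T_pW)` its Λ-adic lift. By Kato §13.9–13.12 the Λ-adic `_{c,d}𝐳(a(A))` is `𝐳_γ` for the cusp class
`γ = (c² − c⟨c⟩)(d² − d⟨d⟩)·δ(f,1,a(A))`, whose `+`-part has `per_f`-coordinate `R_𝟙·Ω⁺_f`,
`R_𝟙 = ratCuspFactor f true c d a A d′` (the parity cross-over (P1)/(P2) of `EulerSystemValues.lean`: even
characters see the minus modular symbols); the bottom layer of `𝐳_γ` depends on `γ⁺` only (complex conjugation
acts trivially on `H¹(ℚ,T)`, `p` odd). Hence `z† := z_{0,∅}/(q·R_𝟙)` is the element of `H¹(ℤ[1/p],V_pW)` whose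
twisted dual-exponential values are EXACTLY `L_{pA}(f,χ,1)/Ω^±_f` (constant `1`) — Burns–Kurihara–Sano's
`z_ℚ(ξ,S)` with `Ω_ξ = Ω⁺_f`, `S = prime(pA)` — independent of `(c,d,a,A)` and of the lattice scale, and
**`ℒ := log_ω(loc_p z†)·(Ω⁺_f/Ω_W) / (∏_{ℓ∣pA} P_ℓ(ℓ⁻¹) · log_ω(x)²)`** (the last conjunct of `PRRatioBody`). Perrin-Riou's
conjecture in the form of Burns–Kurihara–Sano Thm. 1.4 / Conj. 2.8 (ii),
`log_ω(z_ℚ) = (L′_S(E,1)/(Ω_ξ·⟨x,x⟩_∞))·log_ω(x)²` with `L′_S = L′·∏_{ℓ∈S} P_ℓ(ℓ⁻¹)`, reads EXACTLY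
`ℒ = u · L′(W,1)/(Ω_W·Reg W)` with `u ∈ ℤ_pˣ` the (Z2)-unit: so `PerrinRiouUpToUnitAt PRRatio W p` IS BKS Conj. 2.8
(ii) up to a `p`-adic unit, in `Ω_W`-currency, with no period comparison hidden in the unit (the comparison
`Ω_γ ≡ Ω_W`, Kato Prop. 14.21–14.22 / BKS p. 8, belongs to the COUNT reading, where it is print).

SCALE AUDIT (why `v_p ℒ` is an invariant of `(W,p)` on the data; kernel-free, PRINT: Kato Thm. 12.4 + Rohrlich):
`z ↦ n•z` forces `q ↦ nq`, `t ↦ nt` (ℒ fixed); `d ↦ s•d` forces `s ∈ ℚ` by the rationality (C4) of the values and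
`v_p s = 0` by (Z2) (ℒ ↦ sℒ, a unit); `Λˣ`-rescalings are excluded by the single constant for all characters (C5);
the «Haar junk» of memo v10 §2 by (Z1); `(c,d,a,A)` by (Z4); `x ↦ ±x + torsion` by the square; (viii) an
exp*-INVISIBLE norm-coherent perturbation `𝐲 ↦ 𝐲 + 𝐰` (`𝐰 ∈ 𝐇¹_Γ(T_pW)` with all twisted dual-exponential values `0`)
is killed WITHOUT a universal-norms input: `𝐇¹_Γ(T_pW)` is torsion-free of `Λ`-rank one (Kato Thm. 12.4 (2), no
image hypothesis), so `b𝐰 = a𝐳` in `Λ`, and `exp* ≡ 0` forces `a(χ) = 0` at the infinitely many `χ` with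
`L(E,χ̄,1) ≠ 0` (Rohrlich), whence `a = 0`, `𝐰 = 0` (planner D360 (Q1)); (ix) the DEGENERATE scale `q = 0` — the ZERO
family is exp*-invisible, its lift is `0`, its Kummer logarithm `t = 0`, and Lean's `x / 0 = 0` would make `ℒ = 0` a
witness for EVERY `(W,p)`, turning the consumers' clause «`ℒ ≠ 0 ↔ [H¹(ℤ[1/p],T) : z] ≠ 0`» of the count reading
(`RankOneCountReading`) into a print-FALSE hypothesis — is excluded by **(Z0) `q ≠ 0`** (v1.0 of this file, p607915,
lacked (Z0); v1.1 adds it; declaration names and all other conjuncts unchanged; with (Z0), `q ≠ 0` and (viii) give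
`t = log_ω(loc_p 𝐲₀)` with `𝐲 ≠ 0`, and `ℒ ≠ 0` is then exactly Perrin-Riou's non-vanishing, BKS Conj. 2.8 (i), as the
node `PerrinRiouUpToUnitAt` intends). JUNK AUDIT (D137):
the predicate is not `⊥` — it is REALISABLE for every rank-one `(W,p)`, `p` odd, by PRINT (Kato 2004 (8.1.3)/13.3,
8.12, 9.7, 6.6 (1) with BK90 §3 = W2's fact `exists_eulerSystem_definedExpStar_values` [+ when `W[p]` is reducible —
e.g. the CM class 𝒞₇ at `p = 7` — Kato's construction at Kato's MEMBER `E_•` of the isogeny class ((8.1.3)/Ex. 13.3,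
8.12, 9.7, 6.6 (1) carry NO image hypothesis) + ℚ-isogeny transport of the classes (`EulerSystemIsogenyTransportZeta`),
ℒ being scale-free; a kernel DISCHARGE of the consumers' `HasPRRatio PRRatio` there needs W2's fact re-typed at the
member without `Irr` — one named fact, not minted here (planner D360 (Q3))]; (Z2) = W2's S5b fact; `κ_f, Ω⁺_f/Ω_W ∈ ℚˣ` by the modular
parametrisation [Manin; Cremona; not in Kato]; `R_𝟙 ≠ 0` for some admissible `(c,d,a,A)` since the minus symbols of
`f` are not all zero; rkm's lift theorem; rank one ⇒ `loc_p z ∈ H¹_f` [Kato (14.9.3), BKS Hyp. 2.2];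
Mordell–Weil) — this realisability is what the consumers' reading `HasPRRatio PRRatio` now SAYS; and it is not of
`(· = 1)`-type: `v_p ℒ` is whatever Kato's element gives. AT `p = 2` THE PREDICATE IS EMPTY BY DESIGN (first
witness `p ≠ 2`; rkm's lift is the odd-`p` one): `PerrinRiouUpToUnitAt PRRatio W 2` is NOT Perrin-Riou's conjecture —
do not instantiate at `2` (`not_prRatio_two`).

WHAT THIS IS NOT: not a proof of anything about `z`, not a uniqueness theorem for the datum (print, above), not a
construction of `exp*` (W2's) or of `𝐇¹` (rkm's); no claim at `p = 2`; `IsOf`/`KMC` of the descent files stay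
binders (the matching closed `IsOf` = cn100's v2 pin + «`eH D.z` is a `Λˣ`-multiple of `𝐲`» is a separate item).

References: B. Perrin-Riou, Ann. Inst. Fourier 43 (1993) 945–995, §3.3 [PerrinRiou1993AIF]; D. Burns, M. Kurihara,
T. Sano, arXiv:1910.07404 = JMSJ 76 (2024), Thm. 1.4 (p. 4), Conj. 2.8 (p. 10), Hyp. 2.2 (p. 9), Thm. 7.3 (p. 29)
[BurnsKuriharaSano2019]; K. Kato, Astérisque 295 (2004): (8.1.3) p. 180, Prop. 8.12 p. 186, §9.4 p. 188, Thm. 9.7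
p. 189, Thm. 6.6 (1) p. 163, Thm. 12.4–12.5 pp. 221–222, §13.1–Ex. 13.3 pp. 224–225, §13.9–13.12 pp. 229–231,
(14.9.3) p. 240, Prop. 14.21–14.22 pp. 247–249 [Kato2004Asterisque]; S. Bloch, K. Kato (1990) §3, Prop. 3.8,
Ex. 3.11 [BlochKato1990]; K. Kato, LNM 1553 (1993) Ch. II Thm. 1.4.1 [Kato1993LNM1553]; A. Burungale,
C. Skinner, App. A to arXiv:2210.10730, §10.1.2–10.1.3 [AlpogeBhargavaShnidman2022]; tree:
`Kato2004/EulerSystemValues.lean` (`ZetaBody`), `Kato2004/EulerSystemDefinedValues.lean` (`DefinedExpStarBody`),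
`PAdicHodge/DualExpElliptic.lean` (`expStarCoord`, S5b), `Kato2004/IwasawaCohomology*.lean`,
`Kato2004/LocPKummerLog.lean`, `Kato2004/MemberMultiplierInputs.lean`; design record
`pub/bsd-potss/bsd-potss-kmc/KMC-DESCENT-MEMO-v9.md` §2, `-v10.md` §1–§3.
-/

noncomputable section

open scoped BigOperators NumberField TensorProduct Classical
open Field IsDedekindDomain NumberField CongruenceSubgroup ValuativeRel
open Literature.NumberTheory.GaloisRepresentations
open Literature.NumberTheory.GaloisRepresentations.PeriodRingData
open Literature.NumberTheory.GaloisRepresentations.IsNonarchimedeanLocalField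
open Literature.NumberTheory.PAdicHodge
open Literature.NumberTheory.EllipticCurves Literature.NumberTheory.EllipticCurves.ModularForms
open Literature.NumberTheory.AdelicBaseChange Literature.NumberTheory.Automorphic

namespace Literature.NumberTheory.EllipticCurves.Kato2004

open EulerSystemValues Rat.HeightOneSpectrum

/-! ## §1 The predicate with the `ℤ_p`-structure facts of `T_pW` as instance binders -/

set_option backward.isDefEq.respectTransparency false in
/-- **`PRRatioBody W p ℒ` — «`ℒ` is the Perrin-Riou ratio of a VALUE-PINNED Kato zeta datum of `(W,p)`»**
(module docstring (Z1)–(Z5)), the three `ℤ_p`-structure facts of `T_pW` being instance BINDERS (as in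
`ZetaBody`). The witnesses, in order: `p ≠ 2` (rkm's cyclotomic lift is the odd-`p` one); the level `N ≠ 0` and
the newform `f` of `W`; W2's datum `(ι, q, Λ)` with a RATIONAL constant `q`, **(Z0)** `q ≠ 0` (W2's fact carries
`κK ≠ 0`; the degenerate scale is excluded, see the module docstring (ix)) — and, for SOME generator `d` of the
Néron line `D⁰_dR(V_pW|_{Γ_{ℚ_v}})` (`v` the place over `p`), **(Z1)** `DefinedExpStarBody W p f d ι q Λ` (Kato's
Euler system with the semi-local dual exponential DEFINED in the coordinate `d`) **and (Z2)** the Tate-duality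
normalisation of `d`: for every `a ∈ ℚ_v`, `a = exp*_d(η)` for some continuous crossed homomorphism
`η : Γ_{ℚ_v} → T_pW` iff `a·log_ω(Q) ∈ ℤ_p` for every `Q ∈ W(ℚ_p)` (`exp*_d =` W2's `PAdicHodge.expStarCoord`,
`log_ω = Kato2004.padicLogLocal`, `a` read in `ℚ_p` along Mathlib's `ℚ_p ≃ ℚ_v`; the shape of W2's fact
`exists_smul_range_expStarCoord_iff_trace_log` at `F = ℚ_v`, which pins `d` up to `ℤ_pˣ`); Kato's parameters
`(c, d₁, a, A, d′)` with the printed guards `A ≥ 1`, `(c, 6pA) = 1`, `(d₁, 6pN) = 1` (Ex. 13.3), `d₁d′ ≡ 1 (A)`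
(Lemma 13.10 (1)) and the calibration guard **(Z4)** `R_𝟙 = ratCuspFactor f true c d₁ a A d′ ≠ 0`; THE family `z`
(classes) / `x` (values) with `ZetaBody W p f ι q Λ c d₁ a A z x` for the SAME `(Λ, q)`; **(Z5)** a cyclotomic
`ℤ_p`-tower datum `(K, γ)`, rkm's pinned `𝐇¹_Γ(T_pW)` `I` and THE Λ-adic lift `y` of the `p`-power levels of `z`
(`I.proj n y = Cor_{ℚ(μ_{p^{n+1}})/ℚ_n} z_{n+1,∅}` — rkm's `existsUnique_lift_of_zetaBody`: it exists and is
unique); the Kummer logarithm `t = log_ω(loc_p y₀)` (cn100's `HasLocPKummerLog` on `layerZeroToTop (I.proj 0 y)`);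
a generator `P` of `W(ℚ)` modulo torsion; the rational period ratio `λ = Ω⁺_f/Ω_W`; and finally
**`ℒ = t·λ / (q · R_𝟙 · ∏_{ℓ∣pA} eulerFactorAtOne W N ℓ) / log_ω(P)²`**. The local-field structure of `ℚ_v` is
W2's `letI` chain of `DefinedExpStarBody`, verbatim, with the tree's `ℚ`-algebra structure of `ℚ_v` pinned. A
`Prop`; nothing asserted.
[cite: Kato2004Asterisque, (8.1.3) (p. 180), Prop. 8.12 (p. 186), §9.4 (p. 188), Thm. 9.7 (p. 189), Thm. 6.6 (1) (p. 163), Ex. 13.3 (pp. 224–225), Lemma 13.10 (1) (p. 230), §13.12 (p. 231)]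
[cite: Kato1993LNM1553, Ch. II Thm. 1.4.1 (3)–(4)] [cite: BlochKato1990, Prop. 3.8 (p. 354) and Example 3.11 (p. 361)]
[cite: BurnsKuriharaSano2019, Thm. 1.4 (p. 4), Hyp. 2.2 (p. 9) and Conj. 2.8 (p. 10)] [cite: PerrinRiou1993AIF, §3.3] -/
def PRRatioBody (W : WeierstrassCurve ℚ) [W.IsElliptic] [W.IsGloballyMinimal] (p : ℕ) [Fact p.Prime]
    [ContinuousSMul ℤ_[p] (W.tateModule p)] [Module.Free ℤ_[p] (W.tateModule p)]
    [Module.Finite ℤ_[p] (W.tateModule p)] (ℒ : ℚ_[p]) : Prop :=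
  letI ρT := restrictedTateRep W (NumberField.Place.Completion (Sum.inr ((Rat.HeightOneSpectrum.primesEquiv (R := 𝓞 ℚ)).symm ⟨p, Fact.out⟩) : NumberField.Place ℚ)) p
  letI : ValuativeRel (NumberField.Place.Completion (Sum.inr ((Rat.HeightOneSpectrum.primesEquiv (R := 𝓞 ℚ)).symm ⟨p, Fact.out⟩) : NumberField.Place ℚ)) :=
    inferInstanceAs (ValuativeRel (((Rat.HeightOneSpectrum.primesEquiv (R := 𝓞 ℚ)).symm ⟨p, Fact.out⟩).adicCompletion ℚ))
  letI : TopologicalSpace (NumberField.Place.Completion (Sum.inr ((Rat.HeightOneSpectrum.primesEquiv (R := 𝓞 ℚ)).symm ⟨p, Fact.out⟩) : NumberField.Place ℚ)) :=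
    inferInstanceAs (TopologicalSpace (((Rat.HeightOneSpectrum.primesEquiv (R := 𝓞 ℚ)).symm ⟨p, Fact.out⟩).adicCompletion ℚ))
  haveI : IsNonarchimedeanLocalField (NumberField.Place.Completion (Sum.inr ((Rat.HeightOneSpectrum.primesEquiv (R := 𝓞 ℚ)).symm ⟨p, Fact.out⟩) : NumberField.Place ℚ)) :=
    inferInstanceAs (IsNonarchimedeanLocalField (((Rat.HeightOneSpectrum.primesEquiv (R := 𝓞 ℚ)).symm ⟨p, Fact.out⟩).adicCompletion ℚ))
  haveI : CharZero (NumberField.Place.Completion (Sum.inr ((Rat.HeightOneSpectrum.primesEquiv (R := 𝓞 ℚ)).symm ⟨p, Fact.out⟩) : NumberField.Place ℚ)) := LocalField.charZero_adicCompletion ((Rat.HeightOneSpectrum.primesEquiv (R := 𝓞 ℚ)).symm ⟨p, Fact.out⟩)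
  letI : Algebra ℚ_[p] (NumberField.Place.Completion (Sum.inr ((Rat.HeightOneSpectrum.primesEquiv (R := 𝓞 ℚ)).symm ⟨p, Fact.out⟩) : NumberField.Place ℚ)) :=
    LocalField.adicCompletionPadicAlgebra ((Rat.HeightOneSpectrum.primesEquiv (R := 𝓞 ℚ)).symm ⟨p, Fact.out⟩) p ((natCast_mem_asIdeal_iff_eq_primesEquiv_symm _ (Fact.out : p.Prime)).mpr rfl)
  haveI : Fact (¬ IsUnit ((p : ℕ) : integerC (NumberField.Place.Completion (Sum.inr ((Rat.HeightOneSpectrum.primesEquiv (R := 𝓞 ℚ)).symm ⟨p, Fact.out⟩) : NumberField.Place ℚ)))) :=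
    ⟨not_isUnit_natCast_integerC (show valuation (NumberField.Place.Completion (Sum.inr ((Rat.HeightOneSpectrum.primesEquiv (R := 𝓞 ℚ)).symm ⟨p, Fact.out⟩) : NumberField.Place ℚ)) ((p : ℕ) : (NumberField.Place.Completion (Sum.inr ((Rat.HeightOneSpectrum.primesEquiv (R := 𝓞 ℚ)).symm ⟨p, Fact.out⟩) : NumberField.Place ℚ))) < 1 from LocalField.valuation_adicCompletion_natCast_lt_one ((Rat.HeightOneSpectrum.primesEquiv (R := 𝓞 ℚ)).symm ⟨p, Fact.out⟩) p ((natCast_mem_asIdeal_iff_eq_primesEquiv_symm _ (Fact.out : p.Prime)).mpr rfl))⟩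
  haveI := isAdicComplete_integerC_natCast (show valuation (NumberField.Place.Completion (Sum.inr ((Rat.HeightOneSpectrum.primesEquiv (R := 𝓞 ℚ)).symm ⟨p, Fact.out⟩) : NumberField.Place ℚ)) ((p : ℕ) : (NumberField.Place.Completion (Sum.inr ((Rat.HeightOneSpectrum.primesEquiv (R := 𝓞 ℚ)).symm ⟨p, Fact.out⟩) : NumberField.Place ℚ))) < 1 from LocalField.valuation_adicCompletion_natCast_lt_one ((Rat.HeightOneSpectrum.primesEquiv (R := 𝓞 ℚ)).symm ⟨p, Fact.out⟩) p ((natCast_mem_asIdeal_iff_eq_primesEquiv_symm _ (Fact.out : p.Prime)).mpr rfl))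
  -- the tree's `ℚ`-algebra structure on `ℚ_v` (the one W2's restricted representations are built on) is pinned
  -- as the most recent local instance, so that it — and not `DivisionRing.toRatAlgebra` — is synthesized below
  letI : Algebra ℚ (NumberField.Place.Completion (Sum.inr ((Rat.HeightOneSpectrum.primesEquiv (R := 𝓞 ℚ)).symm ⟨p, Fact.out⟩) : NumberField.Place ℚ)) := NumberField.Place.instAlgebraCompletion (Sum.inr ((Rat.HeightOneSpectrum.primesEquiv (R := 𝓞 ℚ)).symm ⟨p, Fact.out⟩) : NumberField.Place ℚ)
  ∃ (hp : p ≠ 2) (N : ℕ) (_ : NeZero N) (f : CuspForm (Gamma0 N) 2) (_ : IsNewformOf W f)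
    (ι : (n : ℕ) → (CyclotomicField n ℚ →+* ℂ)) (q : ℚ)
    (Λ : ∀ (k : ℕ) (r : Finset (HeightOneSpectrum (𝓞 ℚ))),
      H1 (tateRep W p) (cycSubgroup p k r) →ₗ[ℤ_[p]] ℚ_[p] ⊗[ℚ] CyclotomicField (cycLevel p k r) ℚ),
    -- (Z0) the constant of the value law is NON-ZERO (as in W2's fact `exists_eulerSystem_definedExpStar_values`:
    -- «`κK ≠ 0 ∧ DefinedExpStarBody …`»); at `q = 0` the exp*-invisible ZERO family would be a witness, with `ℒ = 0`
    q ≠ 0 ∧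
    -- (Z1) ∧ (Z2)
    (∃ d, DefinedExpStarBody W p f d ι ((q : ℚ) : ℝ) Λ ∧
      ∀ a : (NumberField.Place.Completion (Sum.inr ((Rat.HeightOneSpectrum.primesEquiv (R := 𝓞 ℚ)).symm ⟨p, Fact.out⟩) : NumberField.Place ℚ)),
        (∃ η : contOneCocycles ρT.toTopRep, expStarCoord W (show valuation (NumberField.Place.Completion (Sum.inr ((Rat.HeightOneSpectrum.primesEquiv (R := 𝓞 ℚ)).symm ⟨p, Fact.out⟩) : NumberField.Place ℚ)) ((p : ℕ) : (NumberField.Place.Completion (Sum.inr ((Rat.HeightOneSpectrum.primesEquiv (R := 𝓞 ℚ)).symm ⟨p, Fact.out⟩) : NumberField.Place ℚ))) < 1 from LocalField.valuation_adicCompletion_natCast_lt_one ((Rat.HeightOneSpectrum.primesEquiv (R := 𝓞 ℚ)).symm ⟨p, Fact.out⟩) p ((natCast_mem_asIdeal_iff_eq_primesEquiv_symm _ (Fact.out : p.Prime)).mpr rfl)) d η = a) ↔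
          ∀ Q : (W.baseChange ℚ_[p]).toAffine.Point,
            ‖(Padic.adicCompletionEquiv (𝓞 ℚ) ⟨p, Fact.out⟩).symm
                (show ((Rat.HeightOneSpectrum.primesEquiv (R := 𝓞 ℚ)).symm ⟨p, Fact.out⟩).adicCompletion ℚ from a) * padicLogLocal W p Q‖ ≤ 1) ∧
    -- Kato's parameters, the printed guards, the calibration guard (Z4)
    ∃ (c d₁ a : ℤ) (A : ℕ) (d' : ℤ),
      0 < A ∧ Int.gcd c (6 * p * A) = 1 ∧ Int.gcd d₁ (6 * p * N) = 1 ∧ (d₁ : ℤ) * d' ≡ 1 [ZMOD (A : ℤ)] ∧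
      ratCuspFactor f true c d₁ a A d' ≠ 0 ∧
    -- THE family for `(c, d₁, a, A)` under the same `(Λ, q)`
    ∃ (z : ∀ (k : ℕ) (r : (cyclotomicLevelsRat p (badPlaces c d₁ A N)).Ideals),
        H1 (tateRep W p) ((cyclotomicLevelsRat p (badPlaces c d₁ A N)).level k r.1))
      (x : ∀ (k : ℕ) (r : (cyclotomicLevelsRat p (badPlaces c d₁ A N)).Ideals),
        CyclotomicField (cycLevel p k r.1) ℚ),
      ZetaBody W p f ι ((q : ℚ) : ℝ) Λ c d₁ a A z x ∧
    -- (Z5) the Λ-adic lift of the `p`-power levels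
    ∃ (K : ZpExtension ℚ p) (hK : K.IsCyclotomic) (γ : absoluteGaloisGroup ℚ) (_ : K.IsTopGenerator γ)
      (I : IwasawaH1Data W p K γ) (y : I.H),
      (∀ n : ℕ, I.proj n y =
        levelToLayer W p hK hp (badPlaces c d₁ A N) n
          (z (n + 1) (cyclotomicLevelsRat p (badPlaces c d₁ A N)).idealOne)) ∧
    -- the Kummer logarithm of the bottom class, a generator of `W(ℚ)/tors`, the period ratio, and `ℒ`
    ∃ (t : ℚ_[p]) (P : W.toAffine.Point) (perRatio : ℚ),
      HasLocPKummerLog W p (layerZeroToTop W p K (I.proj 0 y)) t ∧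
      (∀ Q : W.toAffine.Point, ∃ n : ℤ, IsOfFinAddOrder (Q - n • P)) ∧
      plusPeriod f = ((perRatio : ℚ) : ℝ) * W.realPeriodRat ∧
      ℒ = t * ((perRatio : ℚ) : ℚ_[p]) /
            (((q * ratCuspFactor f true c d₁ a A d' *
                ∏ ℓ ∈ (p * A).primeFactors, eulerFactorAtOne W N ℓ : ℚ)) : ℚ_[p]) /
          (padicLogLocal W p
              (WeierstrassCurve.Affine.Point.map (W' := W.toAffine) (S := ℚ) (Algebra.ofId ℚ ℚ_[p]) P)) ^ 2

/-! ## §2 The closed predicate -/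

/-- **`PRRatio W p ℒ` — «`ℒ ∈ ℚ_p` is the Perrin-Riou ratio of Kato's zeta element of `(W, p)`»**, CLOSED:
`PRRatioBody W p ℒ` with the three `ℤ_p`-structure facts of `T_pW` supplied by the tree theorems
(`TateModule.continuousSMul_padicInt`, `module_free_tateModule_holds`, `module_finite_tateModule_holds`). This
is the constructed instance of the interface binder `PRRatio` of
`Summit.BirchSwinnertonDyer.Rank1Residual.Additive.PerrinRiouUpToUnitAt` (and of the readings `HasPRRatio`,
`RankOneCountReading` of the descent files): with it, `PerrinRiouUpToUnitAt PRRatio W p` is Burns–Kurihara–Sano's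
Conj. 2.8 (ii) (= Perrin-Riou 1993 §3.3, the `p`-adic Beilinson–Kato point formula) for `(W,p)` up to a `p`-adic
unit, in `Ω_W`-currency (module docstring). EMPTY at `p = 2` by design (`not_prRatio_two`). A `Prop`; nothing
asserted; realisability is PRINT (module docstring), not claimed here.
[cite: PerrinRiou1993AIF, §3.3] [cite: BurnsKuriharaSano2019, Thm. 1.4 (p. 4) and Conj. 2.8 (p. 10)]
[cite: Kato2004Asterisque, Thm. 12.5 (pp. 221–222) and Ex. 13.3 (pp. 224–225)] -/
def PRRatio (W : WeierstrassCurve ℚ) [W.IsElliptic] [W.IsGloballyMinimal] (p : ℕ) [Fact p.Prime]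
    (ℒ : ℚ_[p]) : Prop :=
  letI : ContinuousSMul ℤ_[p] (W.tateModule p) := TateModule.continuousSMul_padicInt
  letI : Module.Free ℤ_[p] (W.tateModule p) := W.module_free_tateModule_holds p
  letI : Module.Finite ℤ_[p] (W.tateModule p) := W.module_finite_tateModule_holds p
  PRRatioBody W p ℒ

/-- **`PRRatio ↔ PRRatioBody` under ANY instances of the three (`Prop`-valued, hence subsingleton)
`ℤ_p`-structure facts of `T_pW`** — the consumer's bridge (cn100 / potss files carry them as binders).
[cite: BurnsKuriharaSano2019, Conj. 2.8 (ii) (p. 10)] -/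
theorem prRatio_iff (W : WeierstrassCurve ℚ) [W.IsElliptic] [W.IsGloballyMinimal] (p : ℕ) [Fact p.Prime]
    [i₁ : ContinuousSMul ℤ_[p] (W.tateModule p)] [i₂ : Module.Free ℤ_[p] (W.tateModule p)]
    [i₃ : Module.Finite ℤ_[p] (W.tateModule p)] (ℒ : ℚ_[p]) :
    PRRatio W p ℒ ↔ PRRatioBody W p ℒ := by
  have h₁ : i₁ = TateModule.continuousSMul_padicInt := Subsingleton.elim _ _
  have h₂ : i₂ = W.module_free_tateModule_holds p := Subsingleton.elim _ _
  have h₃ : i₃ = W.module_finite_tateModule_holds p := Subsingleton.elim _ _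
  subst h₁ h₂ h₃
  exact Iff.rfl

/-- `PRRatioBody` gives `PRRatio` (any instances). [cite: BurnsKuriharaSano2019, Conj. 2.8 (ii) (p. 10)] -/
theorem prRatio_of_body {W : WeierstrassCurve ℚ} [W.IsElliptic] [W.IsGloballyMinimal] {p : ℕ} [Fact p.Prime]
    [ContinuousSMul ℤ_[p] (W.tateModule p)] [Module.Free ℤ_[p] (W.tateModule p)]
    [Module.Finite ℤ_[p] (W.tateModule p)] {ℒ : ℚ_[p]} (h : PRRatioBody W p ℒ) : PRRatio W p ℒ :=
  (prRatio_iff W p ℒ).mpr h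

/-- `PRRatio W p ℒ` forces `p ≠ 2`. [cite: Kato2004Asterisque, Thm. 12.5 (4) (p. 222) (`p ≠ 2`)] -/
theorem ne_two_of_prRatio {W : WeierstrassCurve ℚ} [W.IsElliptic] [W.IsGloballyMinimal] {p : ℕ} [Fact p.Prime]
    {ℒ : ℚ_[p]} (h : PRRatio W p ℒ) : p ≠ 2 := by
  obtain ⟨hp, -⟩ := h
  exact hp

/-- `PRRatio` is EMPTY at `p = 2` (by design): `PerrinRiouUpToUnitAt PRRatio W 2` is not Perrin-Riou's
conjecture and must not be instantiated. [cite: Kato2004Asterisque, Thm. 12.5 (4) (p. 222) (`p ≠ 2`)] -/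
theorem not_prRatio_two (W : WeierstrassCurve ℚ) [W.IsElliptic] [W.IsGloballyMinimal] [Fact (Nat.Prime 2)]
    (ℒ : ℚ_[2]) : ¬ PRRatio W 2 ℒ :=
  fun h => ne_two_of_prRatio h rfl

end Literature.NumberTheory.EllipticCurves.Kato2004

end
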